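import Summits.ResolutionOfSingularities.ResolutionOfSingularities.Theorems.PAlterationPialtTameLU
import Summits.ResolutionOfSingularities.ResolutionOfSingularities.Theorems.PAlterationPialtTameDescent
import Literature.AlgebraicGeometry.Resolution.ZariskiPatchingProperModels
import Literature.AlgebraicGeometry.Resolution.ProjectiveModelsCharts
import Mathlib.RingTheory.EssentialFiniteness
import HarnessLib

/-!
# `Pialt` (crux stmt-ResolutionOfSingularities-0555), line `SketchIdeator2` / Card A: Zariski–Piltant patching with `Reg ↦ LRR`

Helper file for the OPEN stub `stub_tameResolution` (`TameResolution_p`) of the lead's skeleton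
`radicially-regular-endgame` (`--supports stmt-ResolutionOfSingularities-0555`; it does not close
the item). Steps V5–V9 of `Cruxes/Pialt/STUB-PLAN-stub_tameResolution.md`: the port of the
tree's Zariski–Piltant patching programme (`ProperModels.lean`, `ZariskiPatchingProperModels.lean`)
from the predicate `Reg` (regular centre) to the predicate `LRR` (locally radicially regular
centre), ending in the stub MODULO the named fact `Temkin2013` and the open KERNEL
"two-model tame patching" (Piltant 2013, Prop. 5.1 with `P = P_LRR`, open from dimension `4`).

Vocabulary (INLINED in all statements): an integral scheme `Z` is **RR** if an integral regular
`W` maps onto it by a finite, universally injective, surjective `W → Z`; **LRR** if every point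
has an RR open neighbourhood; `X` is **tame** if some proper birational `Z → X` has `Z`
integral, normal and LRR. For a proper model `M` of `K/k` and `𝒪_v ∈ Zar(K/k)`, `v` has an
**LRR centre** on `M` if the centre `M.centre v` has an RR open neighbourhood; a morphism of
proper models `φ : N → M` is **LRR-monotone** (`φ⁻¹(LRR M) ⊆ LRR N`, Piltant's
`πᵢ⁻¹(Reg_P Xᵢ) ⊆ Reg_P Y` for `P = P_LRR`) if every point of `N` mapping into an RR open of `M`
has an RR open neighbourhood. The **kernel** at the field `k` is: any two proper models of any
essentially-finite-type `K/k` are dominated by a third through LRR-monotone morphisms.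

* `exists_properModel_lrrCentre_of_rr` (V5) — the projective closure of an RR affine model
  `Spec T` is a proper model on which every `𝒪_w ⊇ T` has an LRR centre (the chart itself).
* `lrrCentre_of_hom`, `weakStep_of_lrrLe`, `exists_hom_forall_of_weakStep` (V6) — LRR centres
  lift along LRR-monotone morphisms; Zariski's patching of a finite list from the weak
  two-model step, for an ARBITRARY predicate on (model, valuation).
* `lrr_of_forall_lrrCentre` (V7) — a proper model all of whose centres are LRR is LRR (every
  point is a centre).
* `tame_of_twoModelTamePatching_of_temkin2013` (V8) — **the assembly**: `Temkin2013` + the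
  kernel at `k` ⇒ every integral closed subscheme of `ℙⁿ_k` (char `k = p`) is tame: tame LU on
  `K` itself (`exists_rrModel_le_of_temkin2013`), finite RR system by compactness
  (`exists_finite_rrSystem`), projective closures (V5), patching (V6), V7, and normalisation of
  the LRR proper model obtained (`tame_of_lrr_modification`).
* `stub_tameResolution_of_temkin2013_of_twoModelTamePatching` (V9) — **the registered stub
  `stub_tameResolution`, verbatim, from `Temkin2013` and the kernel** (over perfect fields of
  characteristic `p`), via WLOG-projective (`tame_of_forall_normal_isProjectiveOver`). The
  converse (stub ⇒ kernel) is `PAlterationPialtTameExactness.lean`: the cut is exact.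
-/

set_option linter.dupNamespace false -- mandated namespace of this single-conjunct summit

noncomputable section

open CategoryTheory AlgebraicGeometry TopologicalSpace IsLocalRing
open Literature.AlgebraicGeometry Literature.AlgebraicGeometry.Resolution

namespace Summit.ResolutionOfSingularities.ResolutionOfSingularities.Theorems.Pialt.RadiciallyRegular

/-! ## Projective closures of RR affine models (V5) -/

/-- **Projective closure of an RR affine model.** For a finitely generated `k`-subalgebra
`T ⊆ K` with `Frac T = K` and `Spec T` radicially regular, there is a proper model of `K/k`
(the schematic closure of `Spec T ↪ ℙⁿ_k`, `ProjModel.ofChart`) on which every valuation ring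
`𝒪_w ⊇ T` has an LRR centre: the centre `𝔪_w ∩ T` lies in the open chart `Spec T ≅ U ⊆ X̄`
(`ProjModel.ofChart_isCentre`), which is RR. [cite: Piltant2013, §2 (Axiom 5, proper models)] -/
theorem exists_properModel_lrrCentre_of_rr {k K : Type} [Field k] [Field K] [Algebra k K]
    (T : Subalgebra k K) (hT : T.FG) [IsFractionRing T K]
    (hRR : ∃ (W : Scheme.{0}) (h : W ⟶ Spec (.of T)), IsIntegral W ∧ Scheme.IsRegular W ∧
      IsFinite h ∧ UniversallyInjective h ∧ Function.Surjective h.base) :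
    ∃ M : ProperModel k K, ∀ w : ZariskiRiemannSpace k K,
      T.toSubring ≤ w.asValuationSubring.toSubring →
        ∃ U : M.X.Opens, M.centre w ∈ U ∧ ∃ (W : Scheme.{0}) (h : W ⟶ (U : Scheme.{0})),
          IsIntegral W ∧ Scheme.IsRegular W ∧ IsFinite h ∧ UniversallyInjective h ∧
            Function.Surjective h.base := by
  haveI : Algebra.FiniteType k T := T.fg_iff_finiteType.mp hT
  let Y : Scheme.{0} := Spec (CommRingCat.of T)
  let gY : Y ⟶ Spec (.of k) := Spec.map (CommRingCat.ofHom (algebraMap k T))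
  haveI : LocallyOfFiniteType gY :=
    (HasRingHomProperty.Spec_iff (P := @LocallyOfFiniteType)).mpr
      (RingHom.finiteType_algebraMap.mpr ‹_›)
  obtain ⟨n, ρ, hρ, hρg⟩ := ChowLemmaProof.exists_immersion_projectiveSpace k gY
  haveI := hρ
  haveI : NoetherianSpace Y := noetherianSpace_of_isImmersion_projectiveSpace ρ
  haveI : QuasiCompact ρ := inferInstance
  haveI : IsIntegral ρ.image := ChowLemmaProof.isIntegral_image ρ
  haveI : IsProper (Motives.projectiveSpace n k).hom := Motives.isProper_projectiveSpace n k
  let πX : ρ.image ⟶ Spec (.of k) := ρ.imageι ≫ (Motives.projectiveSpace n k).hom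
  have hproj : Motives.IsProjectiveOver (Over.mk πX) :=
    ⟨n, Over.homMk ρ.imageι rfl, inferInstanceAs (IsClosedImmersion ρ.imageι)⟩
  have hj : ρ.toImage ≫ πX = Spec.map (CommRingCat.ofHom (algebraMap k T)) := by
    change ρ.toImage ≫ ρ.imageι ≫ (Motives.projectiveSpace n k).hom = _
    rw [Scheme.Hom.toImage_imageι_assoc, hρg]
  let M : ProjModel k K := ProjModel.ofChart ρ.image πX hproj T ρ.toImage hj
  refine ⟨M.toProperModel, fun w hw => ?_⟩
  -- the centre of `w` is the point `𝔪_w ∩ T` of the chart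
  have hc := ProjModel.ofChart_isCentre ρ.image πX hproj T ρ.toImage hj w
    (Subring.inclusion hw : T.toSubring →+* w.asValuationSubring.toSubring) (fun a => rfl)
  have hcentre : M.toProperModel.centre w =
      ρ.toImage (Spec.map (CommRingCat.ofHom
        (Subring.inclusion hw : T.toSubring →+* w.asValuationSubring.toSubring))
        (closedPoint w.asValuationSubring)) :=
    (ProperModel.eq_centre_of_isCentre (M := M.toProperModel) hc).symm
  refine ⟨ρ.toImage.opensRange, ?_, ?_⟩
  · rw [hcentre]
    exact ⟨_, rfl⟩
  · exact rr_of_iso (Scheme.Hom.isoOpensRange ρ.toImage).hom hRR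

/-! ## LRR centres under LRR-monotone morphisms; patching a finite list (V6) -/

/-- **LRR centres lift along LRR-monotone morphisms** (`φ⁻¹(LRR M) ⊆ LRR N` and
`φ (N.centre v) = M.centre v`). [cite: Piltant2013, Prop. 5.1] -/
theorem lrrCentre_of_hom {k K : Type} [Field k] [Field K] [Algebra k K] {N M : ProperModel k K}
    (φ : N.Hom M)
    (hφ : ∀ y : N.X, (∃ U : M.X.Opens, φ.f.base y ∈ U ∧
      ∃ (W : Scheme.{0}) (h : W ⟶ (U : Scheme.{0})), IsIntegral W ∧ Scheme.IsRegular W ∧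
        IsFinite h ∧ UniversallyInjective h ∧ Function.Surjective h.base) →
      ∃ V : N.X.Opens, y ∈ V ∧ ∃ (W : Scheme.{0}) (h : W ⟶ (V : Scheme.{0})),
        IsIntegral W ∧ Scheme.IsRegular W ∧ IsFinite h ∧ UniversallyInjective h ∧
          Function.Surjective h.base)
    {v : ZariskiRiemannSpace k K}
    (h : ∃ U : M.X.Opens, M.centre v ∈ U ∧ ∃ (W : Scheme.{0}) (h : W ⟶ (U : Scheme.{0})),
      IsIntegral W ∧ Scheme.IsRegular W ∧ IsFinite h ∧ UniversallyInjective h ∧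
        Function.Surjective h.base) :
    ∃ V : N.X.Opens, N.centre v ∈ V ∧ ∃ (W : Scheme.{0}) (h : W ⟶ (V : Scheme.{0})),
      IsIntegral W ∧ Scheme.IsRegular W ∧ IsFinite h ∧ UniversallyInjective h ∧
        Function.Surjective h.base := by
  apply hφ
  have hmap : φ.f.base (N.centre v) = M.centre v := φ.map_centre v
  rw [hmap]
  exact h

/-- **The two-model step in Piltant's monotone form implies the weak two-model step** for the
predicate "LRR centre". [cite: Piltant2013, Prop. 5.1] -/
theorem weakStep_of_lrrLe {k K : Type} [Field k] [Field K] [Algebra k K]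
    (hZ : ∀ M₁ M₂ : ProperModel k K, ∃ (N : ProperModel k K) (φ₁ : N.Hom M₁) (φ₂ : N.Hom M₂),
      (∀ y : N.X, (∃ U : M₁.X.Opens, φ₁.f.base y ∈ U ∧
        ∃ (W : Scheme.{0}) (h : W ⟶ (U : Scheme.{0})), IsIntegral W ∧ Scheme.IsRegular W ∧
          IsFinite h ∧ UniversallyInjective h ∧ Function.Surjective h.base) →
        ∃ V : N.X.Opens, y ∈ V ∧ ∃ (W : Scheme.{0}) (h : W ⟶ (V : Scheme.{0})),
          IsIntegral W ∧ Scheme.IsRegular W ∧ IsFinite h ∧ UniversallyInjective h ∧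
            Function.Surjective h.base) ∧
      (∀ y : N.X, (∃ U : M₂.X.Opens, φ₂.f.base y ∈ U ∧
        ∃ (W : Scheme.{0}) (h : W ⟶ (U : Scheme.{0})), IsIntegral W ∧ Scheme.IsRegular W ∧
          IsFinite h ∧ UniversallyInjective h ∧ Function.Surjective h.base) →
        ∃ V : N.X.Opens, y ∈ V ∧ ∃ (W : Scheme.{0}) (h : W ⟶ (V : Scheme.{0})),
          IsIntegral W ∧ Scheme.IsRegular W ∧ IsFinite h ∧ UniversallyInjective h ∧
            Function.Surjective h.base))
    (M₁ M₂ : ProperModel k K) :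
    ∃ (N : ProperModel k K) (_ : N.Hom M₁), ∀ v : ZariskiRiemannSpace k K,
      ((∃ U : M₁.X.Opens, M₁.centre v ∈ U ∧ ∃ (W : Scheme.{0}) (h : W ⟶ (U : Scheme.{0})),
        IsIntegral W ∧ Scheme.IsRegular W ∧ IsFinite h ∧ UniversallyInjective h ∧
          Function.Surjective h.base) ∨
       (∃ U : M₂.X.Opens, M₂.centre v ∈ U ∧ ∃ (W : Scheme.{0}) (h : W ⟶ (U : Scheme.{0})),
        IsIntegral W ∧ Scheme.IsRegular W ∧ IsFinite h ∧ UniversallyInjective h ∧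
          Function.Surjective h.base)) →
      ∃ U : N.X.Opens, N.centre v ∈ U ∧ ∃ (W : Scheme.{0}) (h : W ⟶ (U : Scheme.{0})),
        IsIntegral W ∧ Scheme.IsRegular W ∧ IsFinite h ∧ UniversallyInjective h ∧
          Function.Surjective h.base := by
  obtain ⟨N, φ₁, φ₂, h₁, h₂⟩ := hZ M₁ M₂
  exact ⟨N, φ₁, fun v hv => hv.elim (lrrCentre_of_hom φ₁ h₁) (lrrCentre_of_hom φ₂ h₂)⟩

/-- **Zariski's patching of a finite list from the weak two-model step, for an arbitrary
predicate** `P` on (proper model, valuation) (Zariski 1944, Fundamental Theorem; Piltant 2013,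
Cor. 5.7: "by applying `n − 1` consecutive times proposition 5.1"): if for any two proper models
there is a proper model over the first on which every valuation satisfying `P` on either
satisfies `P`, then for every `M₀` and every finite list there is `N → M₀` on which every
valuation satisfying `P` on `M₀` or on some member of the list satisfies `P`. (Verbatim
`ProperModel.exists_hom_forall_regCentre` with `RegCentre` replaced by `P`.)
[cite: Piltant2013, Cor. 5.7] -/
theorem exists_hom_forall_of_weakStep {k K : Type} [Field k] [Field K] [Algebra k K]
    (P : ProperModel k K → ZariskiRiemannSpace k K → Prop)
    (hZ : ∀ M₁ M₂ : ProperModel k K, ∃ (N : ProperModel k K) (_ : N.Hom M₁),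
      ∀ v : ZariskiRiemannSpace k K, (P M₁ v ∨ P M₂ v) → P N v)
    (M₀ : ProperModel k K) :
    ∀ l : List (ProperModel k K), ∃ (N : ProperModel k K) (_ : N.Hom M₀),
      ∀ v : ZariskiRiemannSpace k K, (P M₀ v ∨ ∃ M ∈ l, P M v) → P N v
  | [] => ⟨M₀, ProperModel.Hom.id M₀, fun v h =>
      h.elim (fun h0 => h0) fun ⟨_, hM, _⟩ => by simp at hM⟩
  | M :: l => by
    obtain ⟨N, φ, hN⟩ := exists_hom_forall_of_weakStep P hZ M₀ l
    obtain ⟨N', ψ, hN'⟩ := hZ N M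
    refine ⟨N', ψ.comp φ, fun v hv => ?_⟩
    rcases hv with h0 | ⟨M', hM', hP⟩
    · exact hN' v (Or.inl (hN v (Or.inl h0)))
    · rcases List.mem_cons.mp hM' with rfl | hl
      · exact hN' v (Or.inr hP)
      · exact hN' v (Or.inl (hN v (Or.inr ⟨M', hl, hP⟩)))

/-! ## All centres LRR ⇒ the model is LRR (V7) -/

/-- **A proper model all of whose centres are LRR is LRR**: every point of an integral proper
model is the centre of some valuation (`KModel.exists_isCentre_of_isGenericPoint`). (Verbatim
`ProperModel.isRegular_of_forall_regCentre` with `Reg ↦ LRR`.) [cite: Piltant2013, Cor. 5.7] -/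
theorem lrr_of_forall_lrrCentre {k K : Type} [Field k] [Field K] [Algebra k K]
    {M : ProperModel k K}
    (h : ∀ v : ZariskiRiemannSpace k K, ∃ U : M.X.Opens, M.centre v ∈ U ∧
      ∃ (W : Scheme.{0}) (h : W ⟶ (U : Scheme.{0})), IsIntegral W ∧ Scheme.IsRegular W ∧
        IsFinite h ∧ UniversallyInjective h ∧ Function.Surjective h.base) :
    ∀ x : M.X, ∃ U : M.X.Opens, x ∈ U ∧ ∃ (W : Scheme.{0}) (h : W ⟶ (U : Scheme.{0})),
      IsIntegral W ∧ Scheme.IsRegular W ∧ IsFinite h ∧ UniversallyInjective h ∧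
        Function.Surjective h.base := by
  intro x
  have hgen : IsGenericPoint M.toKModel.genericPt (Set.univ : Set M.X) := by
    rw [M.genericPt_eq']
    exact genericPoint_spec M.X
  obtain ⟨v, hv⟩ := M.toKModel.exists_isCentre_of_isGenericPoint hgen x
  rw [ProperModel.eq_centre_of_isCentre hv]
  exact h v

/-! ## The assembly: tame resolution of projective varieties from `Temkin2013` and the kernel (V8) -/

/-- **Tame resolution of an integral projective variety from Temkin's inseparable local
uniformization and two-model tame patching** (the `Reg ↦ LRR` port of
`hasResolution_of_properPatching_of_relLU`; Zariski 1944, Piltant 2013 Prop. 5.1/Cor. 5.7 for the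
predicate `P_LRR`). Let `k` have characteristic `p`, assume the named fact `Temkin2013` and the
KERNEL at `k`: any two proper models of any essentially-finite-type `K/k` are dominated by a
third proper model through LRR-monotone morphisms. Then every integral closed subscheme
`X ⊆ ℙⁿ_k` has a tame resolution. Proof: `X` is a proper model `M₀` of its function field `K`
(affine chart `Spec A`, `ProjModel.ofChart`); tame LU on `K` itself
(`exists_rrModel_le_of_temkin2013`) and compactness (`exists_finite_rrSystem`) give finitely
many RR affine models covering `Zar(K/k)`; their projective closures are proper models with LRR
centres over the respective domination loci (`exists_properModel_lrrCentre_of_rr`); patching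
(`exists_hom_forall_of_weakStep`, `weakStep_of_lrrLe`) gives `φ : N → M₀` with ALL centres of
`N` LRR, so `N.X` is LRR (`lrr_of_forall_lrrCentre`); `φ` is proper birational, and normalising
`N.X` gives the tame resolution (`tame_of_lrr_modification`).
[cite: Piltant2013, Prop. 5.1 and Cor. 5.7; Temkin2013, Thm. 1.3.2] -/
theorem tame_of_twoModelTamePatching_of_temkin2013 (hT : Temkin2013.{0}) (p : ℕ) [Fact p.Prime]
    {k : Type} [Field k] [CharP k p]
    (hZ : ∀ (K : Type) [Field K] [Algebra k K] [Algebra.EssFiniteType k K],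
      ∀ M₁ M₂ : ProperModel k K, ∃ (N : ProperModel k K) (φ₁ : N.Hom M₁) (φ₂ : N.Hom M₂),
        (∀ y : N.X, (∃ U : M₁.X.Opens, φ₁.f.base y ∈ U ∧
          ∃ (W : Scheme.{0}) (h : W ⟶ (U : Scheme.{0})), IsIntegral W ∧ Scheme.IsRegular W ∧
            IsFinite h ∧ UniversallyInjective h ∧ Function.Surjective h.base) →
          ∃ V : N.X.Opens, y ∈ V ∧ ∃ (W : Scheme.{0}) (h : W ⟶ (V : Scheme.{0})),
            IsIntegral W ∧ Scheme.IsRegular W ∧ IsFinite h ∧ UniversallyInjective h ∧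
              Function.Surjective h.base) ∧
        (∀ y : N.X, (∃ U : M₂.X.Opens, φ₂.f.base y ∈ U ∧
          ∃ (W : Scheme.{0}) (h : W ⟶ (U : Scheme.{0})), IsIntegral W ∧ Scheme.IsRegular W ∧
            IsFinite h ∧ UniversallyInjective h ∧ Function.Surjective h.base) →
          ∃ V : N.X.Opens, y ∈ V ∧ ∃ (W : Scheme.{0}) (h : W ⟶ (V : Scheme.{0})),
            IsIntegral W ∧ Scheme.IsRegular W ∧ IsFinite h ∧ UniversallyInjective h ∧
              Function.Surjective h.base))
    {n : ℕ} (X : Scheme.{0}) [IsIntegral X]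
    (ι : X ⟶ (Motives.projectiveSpace n k).left) [IsClosedImmersion ι] :
    ∃ (Z : Scheme.{0}) (π : Z ⟶ X), IsProper π ∧ IsBirational π ∧ IsIntegral Z ∧
      (∀ z : Z, IsIntegrallyClosed (Z.presheaf.stalk z)) ∧
      ∀ z : Z, ∃ U : Z.Opens, z ∈ U ∧ ∃ (W : Scheme.{0}) (h : W ⟶ (U : Scheme.{0})),
        IsIntegral W ∧ Scheme.IsRegular W ∧ IsFinite h ∧ UniversallyInjective h ∧
          Function.Surjective h.base := by
  classical
  haveI : IsProper (Motives.projectiveSpace n k).hom := Motives.isProper_projectiveSpace n k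
  let πX : X ⟶ Spec (.of k) := ι ≫ (Motives.projectiveSpace n k).hom
  have hproj : Motives.IsProjectiveOver (Over.mk πX) := ⟨n, Over.homMk ι rfl, ‹_›⟩
  haveI : LocallyOfFiniteType πX := inferInstance
  -- an affine chart `U = Spec A` of `X`
  obtain ⟨_, ⟨U', hU', rfl⟩, hηU, -⟩ := X.isBasis_affineOpens.exists_subset_of_mem_open
    (Set.mem_univ (genericPoint X)) isOpen_univ
  let U : X.Opens := U'
  have hU : IsAffineOpen U := hU'
  haveI : IsAffine U := hU
  haveI : Nonempty U := ⟨⟨_, hηU⟩⟩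
  let A : Type := Γ(U, ⊤)
  -- `A` is a finitely generated `k`-algebra
  let g : (U : Scheme.{0}) ⟶ Spec (.of k) := U.ι ≫ πX
  let ψ : k →+* A := g.appTop.hom.comp (Scheme.ΓSpecIso (.of k)).inv.hom
  have hψ : ψ.FiniteType := by
    have h1 : g.appTop.hom.FiniteType :=
      (HasRingHomProperty.iff_of_isAffine (P := @LocallyOfFiniteType)).mp inferInstance
    exact h1.comp (RingHom.FiniteType.of_surjective _
      (Scheme.ΓSpecIso (.of k)).symm.commRingCatIsoToRingEquiv.surjective)
  letI : Algebra k A := ψ.toAlgebra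
  haveI hft : Algebra.FiniteType k A := hψ
  -- its fraction field `K`, and `X` as a proper model of `K/k`
  let K : Type := FractionRing A
  let j : Spec (.of A) ⟶ X := U.toScheme.isoSpec.inv ≫ U.ι
  have hj : j ≫ πX = Spec.map (CommRingCat.ofHom (algebraMap k A)) := by
    change (U.toScheme.isoSpec.inv ≫ U.ι) ≫ πX = Spec.map (CommRingCat.ofHom ψ)
    rw [Category.assoc, isoSpec_inv_comp]
    rfl
  let M₀ : ProperModel k K := (ProjModel.ofChart (K := K) X πX hproj A j hj).toProperModel
  -- `A` as a subalgebra `A₀ ⊆ K`, finitely generated with `Frac A₀ = K`; `K/k` is f.g.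
  let toK : A →ₐ[k] K := IsScalarTower.toAlgHom k A K
  let A₀ : Subalgebra k K := toK.range
  have hA₀fg : A₀.FG := by
    rw [show A₀ = Subalgebra.map toK ⊤ from (Algebra.map_top toK).symm]
    exact Subalgebra.FG.map toK hft.out
  haveI hA₀fr : IsFractionRing A₀ K := by
    refine IsFractionRing.of_field A₀ K fun z => ?_
    obtain ⟨a, b, -, rfl⟩ := IsFractionRing.div_surjective (A := A) z
    exact ⟨⟨algebraMap A K a, a, rfl⟩, ⟨algebraMap A K b, b, rfl⟩, rfl⟩
  haveI : Algebra.FiniteType k A₀ := A₀.fg_iff_finiteType.mp hA₀fg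
  haveI : Algebra.EssFiniteType A₀ K :=
    Algebra.EssFiniteType.of_isLocalization K (nonZeroDivisors A₀)
  have hKfg : (⊤ : IntermediateField k K).FG :=
    IntermediateField.fg_top_iff.mpr (Algebra.EssFiniteType.comp k A₀ K)
  -- tame LU on `K` itself, and a finite RR affine system
  have hcov : ∀ v : ZariskiRiemannSpace k K, ∃ T : Subalgebra k K, T.FG ∧ IsFractionRing T K ∧
      T.toSubring ≤ v.asValuationSubring.toSubring ∧
      ∃ (W : Scheme.{0}) (h : W ⟶ Spec (.of T)), IsIntegral W ∧ Scheme.IsRegular W ∧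
        IsFinite h ∧ UniversallyInjective h ∧ Function.Surjective h.base := by
    intro v
    obtain ⟨T, hTO, hTfg, hTfr, hRR⟩ :=
      exists_rrModel_le_of_temkin2013 hT p k K hKfg v.asValuationSubring v.algebraMap_mem
    exact ⟨T, hTfg, hTfr, hTO, hRR⟩
  obtain ⟨𝒯, h𝒯, h𝒯cov⟩ := exists_finite_rrSystem hcov
  -- their projective closures: proper models with LRR centres over the domination loci
  have hM : ∀ T : ↥𝒯, ∃ M : ProperModel k K, ∀ w : ZariskiRiemannSpace k K,
      T.1.toSubring ≤ w.asValuationSubring.toSubring →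
        ∃ U : M.X.Opens, M.centre w ∈ U ∧ ∃ (W : Scheme.{0}) (h : W ⟶ (U : Scheme.{0})),
          IsIntegral W ∧ Scheme.IsRegular W ∧ IsFinite h ∧ UniversallyInjective h ∧
            Function.Surjective h.base := fun T => by
    haveI := (h𝒯 T.1 T.2).2.1
    exact exists_properModel_lrrCentre_of_rr T.1 (h𝒯 T.1 T.2).1 (h𝒯 T.1 T.2).2.2
  choose M hM using hM
  let l : List (ProperModel k K) := 𝒯.attach.toList.map M
  have hlcov : ∀ v : ZariskiRiemannSpace k K, ∃ N ∈ l, ∃ U : N.X.Opens, N.centre v ∈ U ∧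
      ∃ (W : Scheme.{0}) (h : W ⟶ (U : Scheme.{0})), IsIntegral W ∧ Scheme.IsRegular W ∧
        IsFinite h ∧ UniversallyInjective h ∧ Function.Surjective h.base := by
    intro v
    obtain ⟨T, hT𝒯, hTv⟩ := h𝒯cov v
    refine ⟨M ⟨T, hT𝒯⟩, ?_, hM ⟨T, hT𝒯⟩ v hTv⟩
    exact List.mem_map.mpr ⟨⟨T, hT𝒯⟩, Finset.mem_toList.mpr (Finset.mem_attach _ _), rfl⟩
  -- patch: a proper model `N → M₀` all of whose centres are LRR
  haveI : Algebra.EssFiniteType k K := inferInstance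
  obtain ⟨N, φ, hN⟩ := exists_hom_forall_of_weakStep
    (fun (M : ProperModel k K) (v : ZariskiRiemannSpace k K) => ∃ U : M.X.Opens,
      M.centre v ∈ U ∧ ∃ (W : Scheme.{0}) (h : W ⟶ (U : Scheme.{0})),
        IsIntegral W ∧ Scheme.IsRegular W ∧ IsFinite h ∧ UniversallyInjective h ∧
          Function.Surjective h.base)
    (weakStep_of_lrrLe (hZ K)) M₀ l
  have hall : ∀ v : ZariskiRiemannSpace k K, ∃ U : N.X.Opens, N.centre v ∈ U ∧
      ∃ (W : Scheme.{0}) (h : W ⟶ (U : Scheme.{0})), IsIntegral W ∧ Scheme.IsRegular W ∧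
        IsFinite h ∧ UniversallyInjective h ∧ Function.Surjective h.base :=
    fun v => hN v (Or.inr (hlcov v))
  have hNlrr := lrr_of_forall_lrrCentre hall
  -- normalise `N.X → M₀.X = X` (the instance `IsProper φ.f` is stated over `M₀.X`, pass it)
  exact @tame_of_lrr_modification k _ X N.X _ N.π _ φ.f (ProperModel.Hom.isProper φ)
    φ.isBirational hNlrr

/-! ## The stub from `Temkin2013` and the kernel (V9) -/

/-- **`stub_tameResolution` from `Temkin2013` and two-model tame patching.** Under the named
fact `Temkin2013` (Temkin 2013, Thm. 1.3.2, weak form; one Literature leaf away from being a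
theorem of the tree) and the KERNEL "two-model tame patching in characteristic `p`" (Piltant
2013, Prop. 5.1 with `P = P_LRR`, over perfect ground fields; OPEN from dimension `4`), the
registered stub holds verbatim: every integral separated scheme of finite type over a perfect
field of characteristic `p` has a tame resolution. Reduction to projective varieties
(`tame_of_forall_normal_isProjectiveOver`, Chow) and the assembly
`tame_of_twoModelTamePatching_of_temkin2013`. The converse (stub ⇒ kernel) is
`twoModelTamePatching_of_tame` (`PAlterationPialtTameExactness.lean`), so the pair
(`Temkin2013`, kernel) is an EXACT residual of the stub. [cite: Piltant2013, Prop. 5.1; Temkin2013, Thm. 1.3.2] -/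
theorem stub_tameResolution_of_temkin2013_of_twoModelTamePatching (hT : Temkin2013.{0}) (p : ℕ)
    (hp : p.Prime)
    (hZ : ∀ (k : Type) [Field k] [CharP k p] [PerfectField k] (K : Type) [Field K] [Algebra k K]
      [Algebra.EssFiniteType k K], ∀ M₁ M₂ : ProperModel k K,
        ∃ (N : ProperModel k K) (φ₁ : N.Hom M₁) (φ₂ : N.Hom M₂),
        (∀ y : N.X, (∃ U : M₁.X.Opens, φ₁.f.base y ∈ U ∧
          ∃ (W : Scheme.{0}) (h : W ⟶ (U : Scheme.{0})), IsIntegral W ∧ Scheme.IsRegular W ∧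
            IsFinite h ∧ UniversallyInjective h ∧ Function.Surjective h.base) →
          ∃ V : N.X.Opens, y ∈ V ∧ ∃ (W : Scheme.{0}) (h : W ⟶ (V : Scheme.{0})),
            IsIntegral W ∧ Scheme.IsRegular W ∧ IsFinite h ∧ UniversallyInjective h ∧
              Function.Surjective h.base) ∧
        (∀ y : N.X, (∃ U : M₂.X.Opens, φ₂.f.base y ∈ U ∧
          ∃ (W : Scheme.{0}) (h : W ⟶ (U : Scheme.{0})), IsIntegral W ∧ Scheme.IsRegular W ∧
            IsFinite h ∧ UniversallyInjective h ∧ Function.Surjective h.base) →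
          ∃ V : N.X.Opens, y ∈ V ∧ ∃ (W : Scheme.{0}) (h : W ⟶ (V : Scheme.{0})),
            IsIntegral W ∧ Scheme.IsRegular W ∧ IsFinite h ∧ UniversallyInjective h ∧
              Function.Surjective h.base))
    (k : Type) [Field k] [CharP k p] [PerfectField k] (X : Scheme.{0}) (f : X ⟶ Spec (.of k))
    [IsSeparated f] [LocallyOfFiniteType f] [QuasiCompact f] [IsIntegral X] :
    ∃ (Z : Scheme.{0}) (π : Z ⟶ X), IsProper π ∧ IsBirational π ∧ IsIntegral Z ∧
      (∀ z : Z, IsIntegrallyClosed (Z.presheaf.stalk z)) ∧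
      ∀ z : Z, ∃ U : Z.Opens, z ∈ U ∧ ∃ (W : Scheme.{0}) (h : W ⟶ (U : Scheme.{0})),
        IsIntegral W ∧ Scheme.IsRegular W ∧ IsFinite h ∧ UniversallyInjective h ∧
          Function.Surjective h.base := by
  haveI : Fact p.Prime := ⟨hp⟩
  refine tame_of_forall_normal_isProjectiveOver f fun X' f' hi' hproj _ => ?_
  haveI := hi'
  obtain ⟨n, ι, hι⟩ := hproj
  let ι' : X' ⟶ (Motives.projectiveSpace n k).left := ι.left
  haveI : IsClosedImmersion ι' := hι
  exact tame_of_twoModelTamePatching_of_temkin2013 hT p (hZ k) X' ι'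

end Summit.ResolutionOfSingularities.ResolutionOfSingularities.Theorems.Pialt.RadiciallyRegular

end
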